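import Summits.NavierStokesRegularity.NavierStokesRegularity.Theses.QuantisedSymmetry
import Literature.Analysis.FluidPDE.AncientSimilarityVariables
import Literature.Analysis.FluidPDE.TsaiSelfSimilarHolds
import Literature.Analysis.FluidPDE.TypeIAncientMild

/-!
# Strategist sketch for the STRATEGY-CENSUS of crux `PolyhedralDssProfileExists` (stmt-NavierStokesRegularity-1404)

Typed signatures referred to by `STRATEGY-CENSUS.md` (§Strengthen, §Decomposition, §Negation). Everything here
ELABORATES; `not_steadyPolyhedralProfile` is PROVED (the strengthening "steady" is empty, by the tree's Tsai 1998
Liouville theorem). Nothing in this file is a registered stub; the registered alternative line is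
`Lines/polyhedral_cell.lean`.
-/

noncomputable section

namespace Summit.NavierStokesRegularity.NavierStokesRegularity.Cruxes.PolyhedralDssProfileExists.Strategist

open MeasureTheory Set Function Filter Topology
open Literature.Analysis.FluidPDE

set_option linter.dupNamespace false

local notation "ℝ³" => EuclideanSpace ℝ (Fin 3)

/-- The `G`-clauses of the crux (finite, proper rotations, irreducible on `ℝ³`: T/O/I up to conjugacy). -/
def IsPolyhedral (G : Subgroup (ℝ³ ≃ₗᵢ[ℝ] ℝ³)) : Prop :=
  Finite G ∧ (∀ g ∈ G, LinearMap.det (g.toLinearEquiv : ℝ³ →ₗ[ℝ] ℝ³) = 1) ∧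
    (∀ V : Submodule ℝ ℝ³, (∀ g ∈ G, ∀ v ∈ V, g v ∈ V) → V = ⊥ ∨ V = ⊤)

/-! ## §Strengthen, S⁺₁: a STEADY (self-similar, `λ`-continuous) polyhedral profile — EMPTY -/

/-- S⁺₁: a nontrivial `G`-equivariant solution of Leray's backward profile system
`−ΔU + ½U + ½(y·∇)U + (U·∇)U + ∇P = 0` with an `L⁴` profile (every Type-I profile
`(1+|y|)|U| ≤ C₀` is in `L⁴(ℝ³)`). The `s`-independent periodic orbits of the backward Leray system are exactly
these (`isBackwardLeraySolutionOn_const_iff`). -/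
def SteadyPolyhedralProfile : Prop :=
  ∃ G : Subgroup (ℝ³ ≃ₗᵢ[ℝ] ℝ³), IsPolyhedral G ∧ ∃ (U : ℝ³ → ℝ³) (P : ℝ³ → ℝ),
    IsLerayProfile 1 (1 / 2) U P ∧ (∀ g ∈ G, ∀ y, U (g y) = g (U y)) ∧ MemLp U 4 volume ∧ U ≠ 0

/-- **S⁺₁ is refuted by the tree**: Tsai 1998, Thm 1 (`tsai_selfsimilar_holds`: a Leray profile in `L^q`,
`3 < q < ∞`, vanishes) — the symmetry plays no role. -/
theorem not_steadyPolyhedralProfile : ¬ SteadyPolyhedralProfile := by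
  rintro ⟨G, -, U, P, hprof, -, hL4, hne⟩
  exact hne (tsai_selfsimilar_holds one_pos (by norm_num) hprof (q := 4) (by norm_num)
    (by simp) hL4)

/-! ## §Strengthen, S⁺₂: a RIGIDLY ROTATING (rotating-wave) polyhedral orbit — EMPTY for irreducible `G` -/

/-- S⁺₂: the orbit is a rotating wave `U(s, y) = e^{sΩ} V(e^{-sΩ} y)` with a nonzero skew generator `Ω`
(steady in a uniformly rotating frame: the periodic-orbit PDE collapses to an elliptic system for `V`).
Census: `G`-equivariance of every slice forces `e^{sΩ}` to normalise the FINITE group `G` for all `s`, hence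
`Ω = 0` (the identity component of the normaliser of an irreducible finite `G ≤ SO(3)` is trivial), and then
S⁺₁ applies: the class is empty. Stated for the record; not pursued. -/
def RotatingWavePolyhedralProfile : Prop :=
  ∃ G : Subgroup (ℝ³ ≃ₗᵢ[ℝ] ℝ³), IsPolyhedral G ∧ ∃ Ω : ℝ³ →L[ℝ] ℝ³, Ω ≠ 0 ∧ (∀ y, @inner ℝ _ _ (Ω y) y = 0) ∧
    ∃ (V : ℝ³ → ℝ³) (P : ℝ → ℝ³ → ℝ),
      IsBackwardLeraySolutionOn univ 1
        (fun s y => NormedSpace.exp (s • Ω) (V (NormedSpace.exp (-(s • Ω)) y))) P ∧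
      (∀ g ∈ G, ∀ (s : ℝ) (y : EuclideanSpace ℝ (Fin 3)), NormedSpace.exp (s • Ω) (V (NormedSpace.exp (-(s • Ω)) (g y))) =
        g (NormedSpace.exp (s • Ω) (V (NormedSpace.exp (-(s • Ω)) y)))) ∧
      (∃ C₀ : ℝ, ∀ y, (1 + ‖y‖) * ‖V y‖ ≤ C₀) ∧ V ≠ 0

/-! ## §Decomposition B (recorded, NOT filed): profile-and-certify for the period map `𝓡_G` in the sup norm

The finite-certificate form of the ∃-side of line `polyhedral_cell`. `ApproximateCell …` = an EXACTLY Oseen-mild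
cell of the FORCED system (force `f`), with junction defect `d`; the certificate asks `‖f‖, ‖d‖ ≤ ε`, a solvability
bound `K` for the linearised twisted problem, a Lipschitz bound `L` of `D𝓡_G` on the ball of radius `r`, and the
Newton–Kantorovich inequalities. `NewtonKantorovichPeriodMap` is the analytic theorem turning a certificate into an
exact cell (`stub_polyhedralCellExists` of the line). Both elaborate; neither is registered: the explicit constants
relating the forced orbit to the exact flow (Oseen-kernel `L¹` constant, Gronwall factor over the period) must be
fixed before the certificate means anything, and no numerical candidate exists to certify (census §Decomposition). -/

/-- A forced, `G`-equivariant, Oseen-mild approximate cell on the model period with force `f` and junction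
defect `d(x) = v(-c⁻², x) − c v(-1, cx)`. -/
def ApproximateCell (G : Subgroup (ℝ³ ≃ₗᵢ[ℝ] ℝ³)) (c : ℝ) (v f : ℝ → ℝ³ → ℝ³) : Prop :=
  ContinuousOn (uncurry v) (Icc (-1 : ℝ) (-(c ^ 2)⁻¹) ×ˢ univ) ∧
    (∃ M : ℝ, ∀ t ∈ Icc (-1 : ℝ) (-(c ^ 2)⁻¹), ∀ x, ‖v t x‖ ≤ M) ∧
    (∀ t ∈ Icc (-1 : ℝ) (-(c ^ 2)⁻¹), IsWeaklyDivFree (v t)) ∧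
    (∀ s t : ℝ, -1 ≤ s → s < t → t ≤ -(c ^ 2)⁻¹ → IsMildNSSolutionBetween 1 f v s t) ∧
    (∀ g ∈ G, ∀ t ∈ Icc (-1 : ℝ) (-(c ^ 2)⁻¹), ∀ x, v t (g x) = g (v t x))

/-- The linearised twisted-periodic problem about `v` is solvable with bound `K` (quantitative non-degeneracy
of the approximate cell: `‖(I − D𝓡_G(v(-1)))⁻¹‖ ≤ K` in the sup norm, phrased classically): for every bounded
continuous `G`-equivariant weakly divergence-free right-hand side `gdat` there is a datum `h₀` with
`‖h₀‖_∞ ≤ K‖gdat‖_∞` whose LINEARISED (about `v`) Oseen-mild evolution `h` over the period satisfies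
`h₀ − c h(-c⁻², c·) = gdat`. The linearised evolution is written with the symmetric bilinear Duhamel term. -/
def LinearisedTwistedSolvable (G : Subgroup (ℝ³ ≃ₗᵢ[ℝ] ℝ³)) (c K : ℝ) (v : ℝ → ℝ³ → ℝ³) : Prop :=
  ∀ gdat : ℝ³ → ℝ³, Continuous gdat → (∃ B : ℝ, ∀ x, ‖gdat x‖ ≤ B) → IsWeaklyDivFree gdat →
    (∀ g ∈ G, ∀ x, gdat (g x) = g (gdat x)) →
    ∃ (h : ℝ → ℝ³ → ℝ³), (∀ s t : ℝ, -1 ≤ s → s < t → t ≤ -(c ^ 2)⁻¹ → ∀ x,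
        h t x = heatFlow (h s) (t - s) x - oseenDuhamel 1 s v h t x - oseenDuhamel 1 s h v t x) ∧
      (∀ x, h (-1) x - c • h (-(c ^ 2)⁻¹) (c • x) = gdat x) ∧
      (∀ x, ‖h (-1) x‖ ≤ K * ⨆ y, ‖gdat y‖)

/-- Decomposition B, piece 1 (the finite CERTIFICATE; would replace the ∃-stub of the line): an approximate
polyhedral cell with force and junction defect `≤ ε`, solvability bound `K`, and the Newton–Kantorovich
smallness `8 K² L ε ≤ 1` for a Lipschitz bound `L` of the derivative of the period map on the ball of radius
`4Kε` about `v(-1)` — here only NAMED as a real parameter: fixing it by explicit Oseen/Gronwall constants is the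
untyped part (census). -/
def PolyhedralCellCertificate : Prop :=
  ∃ G : Subgroup (ℝ³ ≃ₗᵢ[ℝ] ℝ³), IsPolyhedral G ∧ ∃ c : ℝ, 1 < c ∧ ∃ (ε K L : ℝ), 0 < ε ∧ 0 < K ∧ 0 < L ∧
    8 * K ^ 2 * L * ε ≤ 1 ∧ ∃ (v f : ℝ → ℝ³ → ℝ³), ApproximateCell G c v f ∧
      (∀ t ∈ Icc (-1 : ℝ) (-(c ^ 2)⁻¹), ∀ x, ‖f t x‖ ≤ ε) ∧
      (∀ x, ‖v (-(c ^ 2)⁻¹) x - c • v (-1) (c • x)‖ ≤ ε) ∧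
      LinearisedTwistedSolvable G c K v ∧ MemLp (v (-1)) 4 volume ∧
      (∃ x, 4 * K * ε < ‖v (-1) x‖)

/-- Decomposition B, piece 2 (the analytic theorem, Newton–Kantorovich for `𝓡_G` in the sup norm): a certified
approximate cell has an EXACT `G`-cell within sup-distance `4Kε` of it, with `L⁴` datum (conclusion = the body of
`stub_polyhedralCellExists` of line `polyhedral_cell`, nontriviality from the margin `4Kε < ‖v(-1,x)‖`). As typed
here (with `L` a free parameter not tied to `v`) this is FALSE-able by a bad `L`; it records the SHAPE only. -/
def NewtonKantorovichPeriodMap : Prop :=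
  PolyhedralCellCertificate →
    ∃ G : Subgroup (ℝ³ ≃ₗᵢ[ℝ] ℝ³), IsPolyhedral G ∧ ∃ c : ℝ, 1 < c ∧ ∃ w : ℝ → ℝ³ → ℝ³,
      (ContinuousOn (uncurry w) (Icc (-1 : ℝ) (-(c ^ 2)⁻¹) ×ˢ univ) ∧
        (∃ M : ℝ, ∀ t ∈ Icc (-1 : ℝ) (-(c ^ 2)⁻¹), ∀ x, ‖w t x‖ ≤ M) ∧
        (∀ t ∈ Icc (-1 : ℝ) (-(c ^ 2)⁻¹), IsWeaklyDivFree (w t)) ∧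
        (∀ s t : ℝ, -1 ≤ s → s < t → t ≤ -(c ^ 2)⁻¹ → ∀ x,
          w t x = heatFlow (w s) (t - s) x - oseenDuhamel 1 s w w t x) ∧
        (∀ x, w (-(c ^ 2)⁻¹) x = c • w (-1) (c • x)) ∧
        (∀ g ∈ G, ∀ t ∈ Icc (-1 : ℝ) (-(c ^ 2)⁻¹), ∀ x, w t (g x) = g (w t x))) ∧
      MemLp (w (-1)) 4 volume ∧ ¬ (w (-1) =ᵐ[volume] 0)

/-! ## §Negation: the kill switch in cell form and the two partial negations that ARE theorems -/

/-- ¬(∃-stub) in cell form = a Type-I-in-time Liouville theorem for polyhedral cells (no spatial decay assumed):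
every polyhedral `G`-cell with `L⁴` datum is trivial. Equivalent (via `stub_cellConcatenatesToDss` + Chae–Wolf
Thm 1.1 + `LiouvilleKillsProfile`) to the route's kill switch #3 `PolyhedralTypeILiouville` restricted to DSS
fields; OPEN — no coercive functional is known for a finite stabiliser (census §Negation). -/
def PolyhedralCellLiouville : Prop :=
  ∀ (G : Subgroup (ℝ³ ≃ₗᵢ[ℝ] ℝ³)), IsPolyhedral G → ∀ c : ℝ, 1 < c → ∀ v : ℝ → ℝ³ → ℝ³,
    (ContinuousOn (uncurry v) (Icc (-1 : ℝ) (-(c ^ 2)⁻¹) ×ˢ univ) ∧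
      (∃ M : ℝ, ∀ t ∈ Icc (-1 : ℝ) (-(c ^ 2)⁻¹), ∀ x, ‖v t x‖ ≤ M) ∧
      (∀ t ∈ Icc (-1 : ℝ) (-(c ^ 2)⁻¹), IsWeaklyDivFree (v t)) ∧
      (∀ s t : ℝ, -1 ≤ s → s < t → t ≤ -(c ^ 2)⁻¹ → ∀ x,
        v t x = heatFlow (v s) (t - s) x - oseenDuhamel 1 s v v t x) ∧
      (∀ x, v (-(c ^ 2)⁻¹) x = c • v (-1) (c • x)) ∧
      (∀ g ∈ G, ∀ t ∈ Icc (-1 : ℝ) (-(c ^ 2)⁻¹), ∀ x, v t (g x) = g (v t x))) →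
    MemLp (v (-1)) 4 volume → ∀ x, v (-1) x = 0

end Summit.NavierStokesRegularity.NavierStokesRegularity.Cruxes.PolyhedralDssProfileExists.Strategist

end
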